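import Summits.QuantumFields.YangMills.Theorems.FemtoTransferGapPhysL2
import Summits.QuantumFields.YangMills.Theorems.FemtoTransferGapLevels
import Summits.QuantumFields.YangMills.Theorems.LuscherReductionOneSiteLevelsVariational
import Literature.Analysis.OperatorTheory.PositivityImprovingSpectralGap

/-!
# The zero-flux transfer operator has a NON-DEGENERATE ground state at every fixed lattice:
# `secondValue < topValue` (Perron–Frobenius–Jentzsch), `(ℤ/L)³`, `SU(2)`, every `L ≥ 1`, every real `β`

Fleet-service module of seat ym-infvol-p2 g4 (route `LuscherReduction`, femto rung R2b1; by-product of the spectral-attainment bridge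
`FemtoTransferGapPhysL2 / PhysL2Infinite / Spectral`).  The docstring of the tree's `topValue` says «the Perron–Frobenius eigenvalue, whose
eigenfunction is positive, hence gauge- and twist-invariant»; this file PROVES it and its consequence, the strict fixed-lattice gap of the min–max
numbers: **`secondValue_lt_topValue : secondValue su2Rep L β < topValue su2Rep L β`** (equivalently `levelValue 1 < levelValue 0`).

§4 (appended): `exists_groundState` — the same with `Ω` UNIFORMLY positive (`0 < c ≤ Ω`, from `Ω = λ₀⁻¹K_βΩ ≥ λ₀⁻¹ (inf K_β) ∫Ω`).
§3 (appended): `exists_groundState_gap` — the same package in the tree's trial-function currency: a physical, everywhere-positive, `l2`-normalised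
EXACT ground state `Ω` (`K_βΩ = λ₀Ω` pointwise, `λ₀ = topValue = ‖A‖`) and `θ < λ₀` with `⟨ψ,K_βψ⟩ ≤ θ‖ψ‖²` for every physical `ψ ⊥ Ω`.

Proof.  The `L²` kernel operator `A` of the (bounded, symmetric, STRICTLY POSITIVE) transfer kernel `K_β` is compact, self-adjoint and positivity
improving (Lit `exists_transferOperator`); Jentzsch (Lit `IsPositivityImproving.exists_spectralGap`): a unit a.e.-positive `φ` with `Aφ = ‖A‖φ`, a
simple top eigenvalue, and `‖Aw‖ ≤ θ‖w‖` (`θ < ‖A‖`) on `φ^⊥`.  §1: `A` commutes with the `L²`-isometry of every measure-preserving symmetry of the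
kernel (gauge transformations, centre twists), so the transform of `φ` is again a unit positive top eigenvector, hence (simplicity + positivity)
EQUAL to `φ`: `φ` is a.e. invariant.  §2: its everywhere-defined kernel integral `K_βφ` is then a PHYSICAL zero-flux test function (a.e.-invariant
version of `isPhys_transferApply_coe`) with Rayleigh quotient `‖A‖`, so `‖A‖ ≤ topValue`; and every physical `ψ ⊥ K_βφ` has class in `φ^⊥`, so
`⟨ψ,K_βψ⟩ ≤ θ‖ψ‖²`, whence `secondValue ≤ θ < ‖A‖ ≤ topValue` (tree doors `levelValue_le_of_forall_rayleigh_le`, `rayleigh_le_topValue`).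

HONEST FRAMING: this is the finite-volume, fixed-lattice non-degeneracy of the transfer ground state — «trivial at finite volume» in the physics
literature, here a theorem over the tree's objects; it says NOTHING about the size of the gap, its `β`- or `L`-dependence, the femto laws, infinite
volume, the continuum limit or the Clay mass gap.
-/

set_option autoImplicit false

noncomputable section

open MeasureTheory Filter Topology Real
open Literature.MathematicalPhysics.QuantumFieldTheory
open Literature.MathematicalPhysics.QuantumLattice
open Literature.Analysis.OperatorTheory.YMMatrixModel
open Literature.Analysis.OperatorTheory
open scoped InnerProductSpace BigOperators

namespace Summit.QuantumFields.YangMills.Theorems.FemtoTransferGap.PhysL2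

open Summit.QuantumFields.YangMills.Theorems.FemtoTransferGap

variable {L : ℕ} [NeZero L]

/-! ## §1 Kernel symmetries commute with the `L²` operator; the Jentzsch vector is invariant -/

section Symmetry

variable {β : ℝ} {A : Lp ℝ 2 (configMeasure SU2 L) →L[ℝ] Lp ℝ 2 (configMeasure SU2 L)}
  (hA : ∀ v : Lp ℝ 2 (configMeasure SU2 L),
    (A v : GaugeConfig 3 L SU2 → ℝ) =ᵐ[configMeasure SU2 L] fun U => ∫ V, transferKernel su2Rep β U V * v V ∂configMeasure SU2 L)
  {T : GaugeConfig 3 L SU2 → GaugeConfig 3 L SU2} (hT : MeasurePreserving T (configMeasure SU2 L) (configMeasure SU2 L))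
  (hKT : ∀ U V : GaugeConfig 3 L SU2, transferKernel su2Rep β (T U) (T V) = transferKernel su2Rep β U V)
include hA hT hKT

/-- **A measure-preserving symmetry of the kernel commutes with the `L²` operator**: `A (w ∘ T) = (A w) ∘ T`. [folklore] -/
theorem apply_compMeasurePreserving (w : Lp ℝ 2 (configMeasure SU2 L)) :
    A (Lp.compMeasurePreserving T hT w) = Lp.compMeasurePreserving T hT (A w) := by
  haveI : SecondCountableTopology SU2 := secondCountableTopology_su2
  apply Lp.ext
  have hwm : Measurable (w : GaugeConfig 3 L SU2 → ℝ) := (Lp.stronglyMeasurable w).measurable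
  have h1 := hA (Lp.compMeasurePreserving T hT w)
  have h2 := Lp.coeFn_compMeasurePreserving w hT
  have h3 := Lp.coeFn_compMeasurePreserving (A w) hT
  have h4 : (A w : GaugeConfig 3 L SU2 → ℝ) ∘ T =ᵐ[configMeasure SU2 L]
      (fun U => ∫ V, transferKernel su2Rep β U V * w V ∂configMeasure SU2 L) ∘ T :=
    hT.quasiMeasurePreserving.ae_eq_comp (hA w)
  filter_upwards [h1, h3, h4] with U hU1 hU3 hU4
  rw [hU1, hU3, hU4]
  simp only [Function.comp_apply]
  -- left: replace the class `w ∘ T` by the function under the integral; right: change variables `V = T V'`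
  have hl : ∫ V, transferKernel su2Rep β U V * (Lp.compMeasurePreserving T hT w : GaugeConfig 3 L SU2 → ℝ) V ∂configMeasure SU2 L =
      ∫ V, transferKernel su2Rep β U V * w (T V) ∂configMeasure SU2 L := by
    refine integral_congr_ae ?_
    filter_upwards [h2] with V hV
    rw [hV, Function.comp_apply]
  have hF : Measurable fun V => transferKernel su2Rep β (T U) V * (w : GaugeConfig 3 L SU2 → ℝ) V :=
    (continuous_transferKernel_right β _).measurable.mul hwm
  have hr : ∫ V, transferKernel su2Rep β (T U) V * w V ∂configMeasure SU2 L =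
      ∫ V, transferKernel su2Rep β U V * w (T V) ∂configMeasure SU2 L := by
    rw [← integral_comp_eq_of_measurePreserving hT hF]
    refine integral_congr_ae (ae_of_all _ fun V => ?_)
    simp only [hKT]
  rw [hl, hr]

/-- **The Jentzsch vector is invariant under every measure-preserving kernel symmetry**: if `φ` is the unit, a.e.-positive, SIMPLE top
eigenvector of `A`, then `φ ∘ T = φ` in `L²` (its transform is again a unit positive top eigenvector). [cite: ReedSimonIV1978, Thm XIII.43 and Thm XIII.44] -/
theorem compMeasurePreserving_eq_of_top {φ : Lp ℝ 2 (configMeasure SU2 L)} (hφ1 : ‖φ‖ = 1) (hφpos : IsStrictlyPositiveFun φ)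
    (hAφ : A φ = ‖A‖ • φ) (hsimple : ∀ η : Lp ℝ 2 (configMeasure SU2 L), A η = ‖A‖ • η → η = ⟪φ, η⟫_ℝ • φ) :
    Lp.compMeasurePreserving T hT φ = φ := by
  set η := Lp.compMeasurePreserving T hT φ with hη
  -- `η` is a top eigenvector
  have hAη : A η = ‖A‖ • η := by
    rw [hη, apply_compMeasurePreserving hA hT hKT, hAφ]
    apply Lp.ext
    filter_upwards [Lp.coeFn_compMeasurePreserving (‖A‖ • φ) hT, Lp.coeFn_smul ‖A‖ (Lp.compMeasurePreserving T hT φ),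
      Lp.coeFn_compMeasurePreserving φ hT,
      hT.quasiMeasurePreserving.ae_eq_comp (Lp.coeFn_smul ‖A‖ φ)] with U h1 h2 h3 h4
    rw [h1, h2, Pi.smul_apply, h3]
    exact h4
  -- hence a multiple of `φ`, with a POSITIVE coefficient of modulus one
  have hηc := hsimple η hAη
  have hηpos : IsStrictlyPositiveFun η := by
    have h1 := Lp.coeFn_compMeasurePreserving φ hT
    have h2 : ∀ᵐ U ∂configMeasure SU2 L, 0 < (φ : GaugeConfig 3 L SU2 → ℝ) (T U) := hT.quasiMeasurePreserving.ae hφpos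
    filter_upwards [h1, h2] with U hU h2U
    rw [hU]; exact h2U
  have hμ : (configMeasure SU2 L) ≠ 0 := IsProbabilityMeasure.ne_zero _
  have hcpos : 0 < ⟪φ, η⟫_ℝ := inner_pos (hφpos.isPositiveFun hμ) hηpos
  have hnorm : ‖η‖ = 1 := by rw [hη, Lp.norm_compMeasurePreserving, hφ1]
  have hc1 : ⟪φ, η⟫_ℝ = 1 := by
    have h1 : ‖η‖ = |⟪φ, η⟫_ℝ| * ‖φ‖ := by
      conv_lhs => rw [hηc]
      rw [norm_smul, Real.norm_eq_abs]
    rw [hnorm, hφ1, mul_one, abs_of_pos hcpos] at h1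
    exact h1.symm
  rw [hηc, hc1, one_smul]

/-- In function form: the Jentzsch vector is a.e. invariant under `T`. [cite: ReedSimonIV1978, Thm XIII.43 and Thm XIII.44] -/
theorem ae_comp_eq_of_top {φ : Lp ℝ 2 (configMeasure SU2 L)} (hφ1 : ‖φ‖ = 1) (hφpos : IsStrictlyPositiveFun φ)
    (hAφ : A φ = ‖A‖ • φ) (hsimple : ∀ η : Lp ℝ 2 (configMeasure SU2 L), A η = ‖A‖ • η → η = ⟪φ, η⟫_ℝ • φ) :
    (fun U => (φ : GaugeConfig 3 L SU2 → ℝ) (T U)) =ᵐ[configMeasure SU2 L] (φ : GaugeConfig 3 L SU2 → ℝ) := by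
  have h := Lp.coeFn_compMeasurePreserving φ hT
  rw [compMeasurePreserving_eq_of_top hA hT hKT hφ1 hφpos hAφ hsimple] at h
  filter_upwards [h] with U hU
  exact hU.symm

end Symmetry

/-! ## §2 Physical representative of an a.e.-invariant class; the strict gap -/

/-- a.e.-INVARIANT version of `isPhys_transferApply_coe`: if the class `v` is a.e. invariant under every gauge transformation and every
centre twist, its kernel integral `K_β v` is a physical zero-flux test function. [cite: Luscher1983] -/
theorem isPhys_transferApply_of_ae_invariant (β : ℝ) (v : Lp ℝ 2 (configMeasure SU2 L))
    (hvg : ∀ g : Site 3 L → SU2,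
      (fun U => (v : GaugeConfig 3 L SU2 → ℝ) (gaugeTransform g U)) =ᵐ[configMeasure SU2 L] (v : GaugeConfig 3 L SU2 → ℝ))
    (hvz : ∀ (k : Fin 3) (z : SU2), z ∈ Subgroup.center SU2 →
      (fun U => (v : GaugeConfig 3 L SU2 → ℝ) (twist k z U)) =ᵐ[configMeasure SU2 L] (v : GaugeConfig 3 L SU2 → ℝ)) :
    IsPhys (transferApply β (v : GaugeConfig 3 L SU2 → ℝ)) := by
  haveI : SecondCountableTopology SU2 := secondCountableTopology_su2
  obtain ⟨M, hM0, hM⟩ := exists_norm_transferKernel_le (L := L) β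
  have hvm : Measurable (v : GaugeConfig 3 L SU2 → ℝ) := (Lp.stronglyMeasurable v).measurable
  refine ⟨measurable_transferApply β hvm, ⟨M * Real.sqrt ((configMeasure SU2 L).real Set.univ) * ‖v‖, fun U => ?_⟩,
    fun g U => ?_, fun k z hz U => ?_⟩
  · rw [transferApply_apply]
    exact abs_integral_kernel_mul_le hM hM0 v U
  · rw [transferApply_apply, transferApply_apply]
    have hF : Measurable fun V => transferKernel su2Rep β (gaugeTransform g U) V * (v : GaugeConfig 3 L SU2 → ℝ) V :=
      (continuous_transferKernel_right β _).measurable.mul hvm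
    rw [← integral_comp_eq_of_measurePreserving (measurePreserving_gaugeTransform_configMeasure g) hF]
    refine integral_congr_ae ?_
    filter_upwards [hvg g] with V hV
    simp only [transferKernel_gaugeTransform, hV]
  · rw [transferApply_apply, transferApply_apply]
    have hF : Measurable fun V => transferKernel su2Rep β (twist k z U) V * (v : GaugeConfig 3 L SU2 → ℝ) V :=
      (continuous_transferKernel_right β _).measurable.mul hvm
    rw [← integral_comp_eq_of_measurePreserving (measurePreserving_twist k z) hF]
    refine integral_congr_ae ?_
    filter_upwards [hvz k z hz] with V hV
    simp only [transferKernel_twist su2Rep β k hz, hV]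

/-- **NON-DEGENERATE GROUND STATE AT FIXED LATTICE (Perron–Frobenius–Jentzsch)**: for the `SU(2)` Wilson theory on `(ℤ/L)³`, every `L ≥ 1`
and every real `β`, the second min–max transfer value is STRICTLY below the top one: `λ₁(β,L) < λ₀(β,L)`.  (The top value is the norm of the
`L²` kernel operator, attained at the physical representative `K_βφ` of the positive Jentzsch vector `φ`, which is gauge and twist invariant by
§1; Jentzsch's gap on `φ^⊥` bounds every physical function `l2`-orthogonal to `K_βφ`.) [cite: ReedSimonIV1978, Thm XIII.43 and Thm XIII.44] -/
theorem secondValue_lt_topValue (β : ℝ) : secondValue su2Rep L β < topValue su2Rep L β := by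
  -- the Jentzsch package for the transfer kernel
  obtain ⟨M, hM0, hM⟩ := exists_norm_transferKernel_le (L := L) β
  have hμ : (configMeasure SU2 L) ≠ 0 := IsProbabilityMeasure.ne_zero _
  obtain ⟨A, hA, hsa, hc, himp, hne⟩ := exists_transferOperator (μ := configMeasure SU2 L) (stronglyMeasurable_transferKernel β) hM
    (transferKernel_su2Rep_symm β) (fun U V => transferKernel_pos su2Rep β U V) hμ
  obtain ⟨φ, hφ1, hφpos, hAφ, hsimple, θ, hθ0, hθlt, hgap⟩ := himp.exists_spectralGap hsa hc hne
  have hnA : 0 < ‖A‖ := norm_pos_iff.mpr hne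
  -- a.e. invariance of `φ`, physical representative `Φ := K_β φ`
  have hvg : ∀ g : Site 3 L → SU2, (fun U => (φ : GaugeConfig 3 L SU2 → ℝ) (gaugeTransform g U)) =ᵐ[configMeasure SU2 L]
      (φ : GaugeConfig 3 L SU2 → ℝ) := fun g =>
    ae_comp_eq_of_top hA (measurePreserving_gaugeTransform_configMeasure g) (transferKernel_gaugeTransform su2Rep β g)
      hφ1 hφpos hAφ hsimple
  have hvz : ∀ (k : Fin 3) (z : SU2), z ∈ Subgroup.center SU2 → (fun U => (φ : GaugeConfig 3 L SU2 → ℝ) (twist k z U))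
      =ᵐ[configMeasure SU2 L] (φ : GaugeConfig 3 L SU2 → ℝ) := fun k z hz =>
    ae_comp_eq_of_top hA (measurePreserving_twist k z) (transferKernel_twist su2Rep β k hz) hφ1 hφpos hAφ hsimple
  have hΦ : IsPhys (transferApply β (φ : GaugeConfig 3 L SU2 → ℝ)) := isPhys_transferApply_of_ae_invariant β φ hvg hvz
  set Φ : physSubmodule L := ⟨transferApply β (φ : GaugeConfig 3 L SU2 → ℝ), hΦ⟩ with hΦdef
  -- its class is `A φ = ‖A‖ φ`
  have hclass : toL2 Φ = ‖A‖ • φ := by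
    rw [← hAφ]
    apply Lp.ext
    filter_upwards [coeFn_toL2 Φ, hA φ] with U h1 h2
    rw [h1, h2]
    rfl
  -- `l2 Φ Φ = ‖A‖²`, `qform Φ Φ = ‖A‖³`
  have hl2 : l2 (Φ : GaugeConfig 3 L SU2 → ℝ) Φ = ‖A‖ ^ 2 := by
    rw [← norm_sq_toL2, hclass, norm_smul, Real.norm_eq_abs, abs_of_pos hnA, hφ1, mul_one]
  have hq : qform su2Rep β (Φ : GaugeConfig 3 L SU2 → ℝ) Φ = ‖A‖ ^ 3 := by
    rw [← inner_apply_toL2 hA, hclass, map_smul, hAφ, inner_smul_left, inner_smul_right, inner_smul_right,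
      real_inner_self_eq_norm_sq, hφ1]
    simp only [RCLike.conj_to_real]
    ring
  have hl2pos : 0 < l2 (Φ : GaugeConfig 3 L SU2 → ℝ) Φ := by rw [hl2]; positivity
  -- `‖A‖ ≤ topValue`
  have htop : ‖A‖ ≤ topValue su2Rep L β := by
    have h := rayleigh_le_topValue su2Rep continuous_su2Rep β hΦ hl2pos
    rw [hq, hl2] at h
    have h3 : ‖A‖ ^ 3 / ‖A‖ ^ 2 = ‖A‖ := by field_simp
    rwa [h3] at h
  -- `secondValue ≤ θ`: every physical `ψ ⊥ Φ` has its class in `φ^⊥`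
  have hsec : secondValue su2Rep L β ≤ θ := by
    rw [← levelValue_one]
    refine levelValue_le_of_forall_rayleigh_le su2Rep β hθ0 (fun _ : Fin 1 => (Φ : GaugeConfig 3 L SU2 → ℝ)) (fun _ => hΦ)
      (fun ψ hψ hperp hpos => ?_)
    set Ψ : physSubmodule L := ⟨ψ, hψ⟩ with hΨdef
    have hperp' : ⟪φ, toL2 Ψ⟫_ℝ = 0 := by
      have h1 : ⟪toL2 Ψ, toL2 Φ⟫_ℝ = 0 := by rw [inner_toL2]; exact hperp 0
      rw [hclass, inner_smul_right] at h1
      rw [real_inner_comm]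
      rcases mul_eq_zero.mp h1 with h | h
      · exact absurd h hnA.ne'
      · exact h
    have hbound := hgap (toL2 Ψ) hperp'
    calc qform su2Rep β ψ ψ = ⟪toL2 Ψ, A (toL2 Ψ)⟫_ℝ := (inner_apply_toL2 hA Ψ Ψ).symm
      _ ≤ ‖toL2 Ψ‖ * ‖A (toL2 Ψ)‖ := real_inner_le_norm _ _
      _ ≤ ‖toL2 Ψ‖ * (θ * ‖toL2 Ψ‖) := mul_le_mul_of_nonneg_left hbound (norm_nonneg _)
      _ = θ * ‖toL2 Ψ‖ ^ 2 := by ring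
      _ = θ * l2 ψ ψ := by rw [norm_sq_toL2]
  exact lt_of_le_of_lt hsec (hθlt.trans_le htop)

/-- The same in `levelValue` form: `λ₁(β,L) < λ₀(β,L)`. [cite: ReedSimonIV1978, Thm XIII.43 and Thm XIII.44] -/
theorem levelValue_one_lt_levelValue_zero (β : ℝ) : levelValue su2Rep L β 1 < levelValue su2Rep L β 0 := by
  rw [levelValue_one, levelValue_zero]
  exact secondValue_lt_topValue β


/-! ## §3 (appended) The positive physical ground state and the fixed-lattice gap in trial-function currency -/

/-- **THE PHYSICAL GROUND STATE AND THE GAP, in the tree's trial-function currency** (every `L ≥ 1`, every real `β`): there are a physical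
zero-flux test function `Ω`, EVERYWHERE POSITIVE, `l2`-normalised, an EXACT eigenfunction of the zero-flux transfer operator for the top value
(`K_β Ω = λ₀ Ω` pointwise, `λ₀ = topValue su2Rep L β`), and a constant `θ` with `0 ≤ θ < λ₀` such that every physical `ψ` `l2`-orthogonal to `Ω`
has `⟨ψ, K_β ψ⟩ ≤ θ ‖ψ‖²` (Jentzsch's gap; in particular `λ₁ ≤ θ`).  `Ω = λ₀⁻¹ K_β φ` is the kernel integral of the Jentzsch vector `φ` (§§1–2).
[cite: ReedSimonIV1978, Thm XIII.43 and Thm XIII.44] -/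
theorem exists_groundState_gap (β : ℝ) :
    ∃ (Ω : GaugeConfig 3 L SU2 → ℝ) (θ : ℝ), IsPhys Ω ∧ (∀ U, 0 < Ω U) ∧ l2 Ω Ω = 1 ∧
      transferApply β Ω = topValue su2Rep L β • Ω ∧ 0 ≤ θ ∧ θ < topValue su2Rep L β ∧
      ∀ ψ : GaugeConfig 3 L SU2 → ℝ, IsPhys ψ → l2 ψ Ω = 0 → qform su2Rep β ψ ψ ≤ θ * l2 ψ ψ := by
  -- the Jentzsch package (as in `secondValue_lt_topValue`)
  obtain ⟨M, hM0, hM⟩ := exists_norm_transferKernel_le (L := L) β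
  have hμ : (configMeasure SU2 L) ≠ 0 := IsProbabilityMeasure.ne_zero _
  obtain ⟨A, hA, hsa, hc, himp, hne⟩ := exists_transferOperator (μ := configMeasure SU2 L) (stronglyMeasurable_transferKernel β) hM
    (transferKernel_su2Rep_symm β) (fun U V => transferKernel_pos su2Rep β U V) hμ
  obtain ⟨φ, hφ1, hφpos, hAφ, hsimple, θ, hθ0, hθlt, hgap⟩ := himp.exists_spectralGap hsa hc hne
  have hnA : 0 < ‖A‖ := norm_pos_iff.mpr hne
  have hvg : ∀ g : Site 3 L → SU2, (fun U => (φ : GaugeConfig 3 L SU2 → ℝ) (gaugeTransform g U)) =ᵐ[configMeasure SU2 L]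
      (φ : GaugeConfig 3 L SU2 → ℝ) := fun g =>
    ae_comp_eq_of_top hA (measurePreserving_gaugeTransform_configMeasure g) (transferKernel_gaugeTransform su2Rep β g)
      hφ1 hφpos hAφ hsimple
  have hvz : ∀ (k : Fin 3) (z : SU2), z ∈ Subgroup.center SU2 → (fun U => (φ : GaugeConfig 3 L SU2 → ℝ) (twist k z U))
      =ᵐ[configMeasure SU2 L] (φ : GaugeConfig 3 L SU2 → ℝ) := fun k z hz =>
    ae_comp_eq_of_top hA (measurePreserving_twist k z) (transferKernel_twist su2Rep β k hz) hφ1 hφpos hAφ hsimple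
  have hΦ : IsPhys (transferApply β (φ : GaugeConfig 3 L SU2 → ℝ)) := isPhys_transferApply_of_ae_invariant β φ hvg hvz
  set Φ : physSubmodule L := ⟨transferApply β (φ : GaugeConfig 3 L SU2 → ℝ), hΦ⟩ with hΦdef
  have hclass : toL2 Φ = ‖A‖ • φ := by
    rw [← hAφ]
    apply Lp.ext
    filter_upwards [coeFn_toL2 Φ, hA φ] with U h1 h2
    rw [h1, h2]
    rfl
  have hl2 : l2 (Φ : GaugeConfig 3 L SU2 → ℝ) Φ = ‖A‖ ^ 2 := by
    rw [← norm_sq_toL2, hclass, norm_smul, Real.norm_eq_abs, abs_of_pos hnA, hφ1, mul_one]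
  have hq : qform su2Rep β (Φ : GaugeConfig 3 L SU2 → ℝ) Φ = ‖A‖ ^ 3 := by
    rw [← inner_apply_toL2 hA, hclass, map_smul, hAφ, inner_smul_left, inner_smul_right, inner_smul_right,
      real_inner_self_eq_norm_sq, hφ1]
    simp only [RCLike.conj_to_real]
    ring
  have hl2pos : 0 < l2 (Φ : GaugeConfig 3 L SU2 → ℝ) Φ := by rw [hl2]; positivity
  -- `topValue = ‖A‖`
  have htop_ge : ‖A‖ ≤ topValue su2Rep L β := by
    have h := rayleigh_le_topValue su2Rep continuous_su2Rep β hΦ hl2pos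
    rw [hq, hl2] at h
    have h3 : ‖A‖ ^ 3 / ‖A‖ ^ 2 = ‖A‖ := by field_simp
    rwa [h3] at h
  have htop_le : topValue su2Rep L β ≤ ‖A‖ := by
    rw [← levelValue_zero]
    refine levelValue_zero_le_of_forall_rayleigh_le su2Rep β hnA.le (fun ψ hψ hpos => ?_)
    set Ψ : physSubmodule L := ⟨ψ, hψ⟩ with hΨdef
    calc qform su2Rep β ψ ψ = ⟪toL2 Ψ, A (toL2 Ψ)⟫_ℝ := (inner_apply_toL2 hA Ψ Ψ).symm
      _ ≤ ‖toL2 Ψ‖ * ‖A (toL2 Ψ)‖ := real_inner_le_norm _ _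
      _ ≤ ‖toL2 Ψ‖ * (‖A‖ * ‖toL2 Ψ‖) := mul_le_mul_of_nonneg_left (A.le_opNorm _) (norm_nonneg _)
      _ = ‖A‖ * ‖toL2 Ψ‖ ^ 2 := by ring
      _ = ‖A‖ * l2 ψ ψ := by rw [norm_sq_toL2]
  have htop : topValue su2Rep L β = ‖A‖ := le_antisymm htop_le htop_ge
  -- the eigen-equation for `Φ`, pointwise: `K_β Φ = ‖A‖ Φ`
  have hae : transferApply β (φ : GaugeConfig 3 L SU2 → ℝ) =ᵐ[configMeasure SU2 L] ‖A‖ • (φ : GaugeConfig 3 L SU2 → ℝ) := by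
    have h1 := hA φ
    rw [hAφ] at h1
    filter_upwards [h1, Lp.coeFn_smul ‖A‖ φ] with U hU hs
    rw [transferApply_apply, ← hU, hs]
  have hKΦ : transferApply β (Φ : GaugeConfig 3 L SU2 → ℝ) = ‖A‖ • (Φ : GaugeConfig 3 L SU2 → ℝ) := by
    show transferApply β (transferApply β _) = ‖A‖ • transferApply β _
    rw [transferApply_congr_ae hae, transferApply_smul]
  -- `Φ > 0` everywhere: the kernel is strictly positive and `φ > 0` a.e.
  have hΦpos : ∀ U, 0 < (Φ : GaugeConfig 3 L SU2 → ℝ) U := by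
    intro U
    show 0 < transferApply β (φ : GaugeConfig 3 L SU2 → ℝ) U
    rw [transferApply_apply]
    have hint : Integrable (fun V => transferKernel su2Rep β U V * (φ : GaugeConfig 3 L SU2 → ℝ) V) (configMeasure SU2 L) :=
      integrable_kernel_mul_coeFn (μ := configMeasure SU2 L) (stronglyMeasurable_transferKernel β) hM φ U
    have hnn : 0 ≤ᵐ[configMeasure SU2 L] fun V => transferKernel su2Rep β U V * (φ : GaugeConfig 3 L SU2 → ℝ) V := by
      filter_upwards [hφpos] with V hV using mul_nonneg (transferKernel_pos su2Rep β U V).le hV.le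
    rw [integral_pos_iff_support_of_nonneg_ae hnn hint]
    have hs : Function.support (fun V => transferKernel su2Rep β U V * (φ : GaugeConfig 3 L SU2 → ℝ) V) =
        Function.support (φ : GaugeConfig 3 L SU2 → ℝ) := by
      ext V
      simp only [Function.mem_support, ne_eq, mul_eq_zero, (transferKernel_pos su2Rep β U V).ne', false_or]
    rw [hs, pos_iff_ne_zero]
    intro hz
    have h1 : ∀ᵐ V ∂configMeasure SU2 L, V ∉ Function.support (φ : GaugeConfig 3 L SU2 → ℝ) := measure_eq_zero_iff_ae_notMem.1 hz
    have h2 : ∀ᵐ V ∂configMeasure SU2 L, False := by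
      filter_upwards [h1, hφpos] with V hV hV'
      exact hV (Function.mem_support.2 hV'.ne')
    exact hμ (MeasureTheory.ae_eq_bot.1 (Filter.eventually_false_iff_eq_bot.1 h2))
  -- normalise: `Ω := ‖A‖⁻¹ Φ`
  refine ⟨‖A‖⁻¹ • (Φ : GaugeConfig 3 L SU2 → ℝ), θ, hΦ.smul _, fun U => ?_, ?_, ?_, hθ0, by rw [htop]; exact hθlt, fun ψ hψ hperp => ?_⟩
  · rw [Pi.smul_apply, smul_eq_mul]
    exact mul_pos (inv_pos.mpr hnA) (hΦpos U)
  · rw [l2_smul_left, l2_comm, l2_smul_left, hl2]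
    field_simp
  · rw [transferApply_smul, hKΦ, htop, smul_smul, smul_smul, mul_comm]
  · -- the gap: `ψ ⊥ Ω` puts the class of `ψ` in `φ^⊥`
    set Ψ : physSubmodule L := ⟨ψ, hψ⟩ with hΨdef
    have hperpΦ : l2 ψ (Φ : GaugeConfig 3 L SU2 → ℝ) = 0 := by
      have h1 : l2 ψ (‖A‖⁻¹ • (Φ : GaugeConfig 3 L SU2 → ℝ)) = ‖A‖⁻¹ * l2 ψ (Φ : GaugeConfig 3 L SU2 → ℝ) := by
        rw [l2_comm, l2_smul_left, l2_comm]
      rw [h1] at hperp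
      rcases mul_eq_zero.mp hperp with h | h
      · exact absurd h (inv_ne_zero hnA.ne')
      · exact h
    have hperp' : ⟪φ, toL2 Ψ⟫_ℝ = 0 := by
      have h1 : ⟪toL2 Ψ, toL2 Φ⟫_ℝ = 0 := by rw [inner_toL2]; exact hperpΦ
      rw [hclass, inner_smul_right] at h1
      rw [real_inner_comm]
      rcases mul_eq_zero.mp h1 with h | h
      · exact absurd h hnA.ne'
      · exact h
    have hbound := hgap (toL2 Ψ) hperp'
    calc qform su2Rep β ψ ψ = ⟪toL2 Ψ, A (toL2 Ψ)⟫_ℝ := (inner_apply_toL2 hA Ψ Ψ).symm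
      _ ≤ ‖toL2 Ψ‖ * ‖A (toL2 Ψ)‖ := real_inner_le_norm _ _
      _ ≤ ‖toL2 Ψ‖ * (θ * ‖toL2 Ψ‖) := mul_le_mul_of_nonneg_left hbound (norm_nonneg _)
      _ = θ * ‖toL2 Ψ‖ ^ 2 := by ring
      _ = θ * l2 ψ ψ := by rw [norm_sq_toL2]


/-! ## §4 (appended) The ground state is bounded BELOW by a positive constant -/

/-- An everywhere-positive physical exact eigenfunction of `K_β` with positive eigenvalue is UNIFORMLY positive:
`Ω = λ⁻¹ K_β Ω ≥ λ⁻¹ · (inf K_β) · ∫ Ω > 0`. [folklore] -/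
theorem exists_pos_le_of_eigen {β lam : ℝ} (hlam : 0 < lam) {Ω : GaugeConfig 3 L SU2 → ℝ} (hΩ : IsPhys Ω) (hpos : ∀ U, 0 < Ω U)
    (heig : transferApply β Ω = lam • Ω) : ∃ c : ℝ, 0 < c ∧ ∀ U, c ≤ Ω U := by
  obtain ⟨m, hm, hmK⟩ := exists_pos_le_transferKernel su2Rep continuous_su2Rep β (L := L)
  have hint : Integrable Ω (configMeasure SU2 L) := hΩ.integrable
  have hI : 0 < ∫ V, Ω V ∂configMeasure SU2 L := by
    rw [integral_pos_iff_support_of_nonneg_ae (ae_of_all _ fun V => (hpos V).le) hint]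
    have hs : Function.support Ω = Set.univ := Set.eq_univ_of_forall fun V => Function.mem_support.2 (hpos V).ne'
    rw [hs, measure_univ]
    exact one_pos
  refine ⟨lam⁻¹ * (m * ∫ V, Ω V ∂configMeasure SU2 L), by positivity, fun U => ?_⟩
  have h1 : lam * Ω U = transferApply β Ω U := by rw [heig, Pi.smul_apply, smul_eq_mul]
  have h2 : m * ∫ V, Ω V ∂configMeasure SU2 L ≤ transferApply β Ω U := by
    rw [transferApply_apply, ← integral_const_mul]
    obtain ⟨C, hC⟩ := hΩ.bounded
    exact integral_mono (hint.const_mul m) (integrable_transferKernel_mul β U hΩ.measurable hC) fun V =>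
      mul_le_mul_of_nonneg_right (hmK U V) (hpos V).le
  rw [← h1] at h2
  calc lam⁻¹ * (m * ∫ V, Ω V ∂configMeasure SU2 L) ≤ lam⁻¹ * (lam * Ω U) := mul_le_mul_of_nonneg_left h2 (inv_nonneg.mpr hlam.le)
    _ = Ω U := by rw [← mul_assoc, inv_mul_cancel₀ hlam.ne', one_mul]

/-- **The fixed-lattice ground-state package, complete**: `Ω` physical, an exact top eigenfunction (`K_βΩ = λ₀Ω`, `λ₀ = topValue`),
`l2`-normalised, UNIFORMLY POSITIVE (`0 < c ≤ Ω`), together with Jentzsch's gap `θ < λ₀` on physical `ψ ⊥ Ω` — the exact object that the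
vacuum proxies `slabGround β m` (p475750, `tendsto_rayleigh_slabGround`) approximate; every `L ≥ 1`, every real `β`.
[cite: ReedSimonIV1978, Thm XIII.43 and Thm XIII.44] -/
theorem exists_groundState (β : ℝ) :
    ∃ (Ω : GaugeConfig 3 L SU2 → ℝ) (θ c : ℝ), IsPhys Ω ∧ 0 < c ∧ (∀ U, c ≤ Ω U) ∧ l2 Ω Ω = 1 ∧
      transferApply β Ω = topValue su2Rep L β • Ω ∧ 0 ≤ θ ∧ θ < topValue su2Rep L β ∧
      ∀ ψ : GaugeConfig 3 L SU2 → ℝ, IsPhys ψ → l2 ψ Ω = 0 → qform su2Rep β ψ ψ ≤ θ * l2 ψ ψ := by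
  obtain ⟨Ω, θ, hΩ, hpos, hn, heig, hθ0, hθ, hgap⟩ := exists_groundState_gap (L := L) β
  obtain ⟨c, hc, hcle⟩ := exists_pos_le_of_eigen (topValue_su2Rep_pos L β) hΩ hpos heig
  exact ⟨Ω, θ, c, hΩ, hc, hcle, hn, heig, hθ0, hθ, hgap⟩

end Summit.QuantumFields.YangMills.Theorems.FemtoTransferGap.PhysL2

end
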